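/-
Copyright (c) 2026. All rights reserved.
Released under Apache 2.0 license as described in the file LICENSE.
Authors: HodgeCM publication cell (pub-hodgecm), GR lane, seat GR-2 (`pub-hodgecm-own-hyp34`).
-/
import Literature.NumberTheory.GelbartRogawski1991.QuadExtSplittingCharArchTwist
import Literature.NumberTheory.Weil1964.ArchActQuadraticComplexPlaces
import Literature.NumberTheory.Automorphic.UnitaryGroupAdelicOneTorus
import HarnessLib

/-!
# The archimedean twist at the COMPLEX places of the base, general quadratic `E/F`

Sequel of `QuadExtSplittingCharArchTwist` (the type-(i) places: real places of `F` under a complex place of `E`)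
for the places of type (iii): a COMPLEX place `v` of `F`, which splits in `E` into the pair `w`, `c w` of complex
places.  For the doubled hermitian space `J^𝔻 = e₂ (T ⊕ −T) e₂` and `g ∈ U(J^𝔻)(E ⊗ ℝ)` on the Siegel parabolic
`P_Δ` (Kudla's `x(g) = det(g|_Δ)`, an idèle `u` with trivial finite part):

* `detAtC w : U(J)(E ⊗ ℝ) →* ℂˣ`, `g ↦ σ_w(det g_w)` — the determinant of the `w`-coordinate (continuous);
* `detAtC_mul_conjCoord_eq` — **`σ_w(det g_w) · ψ_{cw}(σ_{cw}(u_{cw})) = σ_w(u_w)`**: the determinant identity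
  `det g · (c ⊗ 1)(x(g)) = x(g)` of `DoubledUnitaryAdaptedSiegelDet.det_mul_map_det_deltaBlock_reindex`, applied over
  the ring `E ⊗ ℝ` with the involution `c ⊗ 1 = conjMixed` and read at `w` (`conjMixed_snd_eq`: at the pair
  `(w, cw)` the involution is the swap, up to the untwisting `ψ_{cw} = conjCoord (cw)`);
* `toInfPlace_surjective_of_isComplex` — the local base change `ι_w : F_v → E_w` at a complex `v` is onto;
* `smul_ne_of_isComplex_comap`, `eq_or_eq_cPlaceC` — over a complex `v` the places are exactly `w ≠ c w`;
* **`archComponentC_detAtC_eq`** — for `χ|_{𝕀_F} = ε_{E/F}^m`: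
  **`(χ_w ∘ σ_w⁻¹)(σ_w(det g_w)) = χ_w(u_w) · χ_{cw}(u_{cw})`**, i.e. the factor of `χ(x(g))` at the two places over
  `v` IS the value of the continuous character `χ_w ∘ det_w` of `U(J^𝔻)(E ⊗ ℝ)` — the local splitting identity
  `χ_w(ι_w x) χ_{cw}(ι_{cw} x) = 1` (`IsSplittingCharExt.archComponent_mul_archComponent_of_isComplex`) at
  `ι_{cw} x = u_{cw}`, where `σ_w(ι_w x) = ψ_{cw}(σ_{cw}(ι_{cw} x))` (`conjCoord_placeTwist_cPlaceC`);
  product form `prod_archComponent_placesOver_eq_archComponentC_detAtC`.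

With `QuadExtSplittingCharArchTwist.exists_archDetTwist_doubled` (type (i)) this is the whole archimedean twist
`η` of [GelbartRogawski1991, Prop. 3.1.1] for `E` totally complex (`DoubledWeilRepresentationArchTwistGen`).

Topic `NumberTheory/GelbartRogawski1991`; KERNEL only: two `MonoidHom` definitions and theorems; no `def … : Prop`,
no named fact, no `sorry`.  Written for the stage-1 cell `pub-hodgecm` (GR lane); nothing here is a claim of the
manuscripts adjudicated by that cell.

## References
* S. S. Kudla, *Splitting metaplectic covers of dual reductive pairs*, Israel J. Math. 87 (1994), §3 [Kudla1994].
* M. Harris, S. S. Kudla, W. J. Sweet, J. Amer. Math. Soc. 9 (1996), §1 (1.5), (1.11)–(1.12) [HarrisKudlaSweet1996].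
* S. Gelbart, J. Rogawski, Invent. Math. 105 (1991), §3.1 p. 456 (3.1.2) [GelbartRogawski1991].
* V. Platonov, A. Rapinchuk, *Algebraic Groups and Number Theory* (1994), §§2.3, 3.2 [PlatonovRapinchuk1994].
-/

set_option autoImplicit false

noncomputable section

open scoped NumberField Classical ComplexConjugate MatrixGroups Matrix
open NumberField NumberField.InfinitePlace NumberField.mixedEmbedding IsDedekindDomain
open _root_.Literature.NumberTheory.Automorphic _root_.Literature.NumberTheory.Automorphic.UnitaryGroup
open _root_.Literature.NumberTheory.GaloisRepresentations
open _root_.Literature.RepresentationTheory.HarrisKudlaSweet1996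
open _root_.Literature.NumberTheory.GelbartRogawski1991.AdaptedBlocks
open _root_.Literature.NumberTheory.Weil1964
open _root_.Literature.NumberTheory.QuadraticForms (ideleInfiniteComponent val_ideleInfiniteComponent)

namespace Literature.NumberTheory.GelbartRogawski1991.UnitaryDualPair.ArchSplitting.QuadExt

variable (F E : Type) [Field F] [NumberField F] [Field E] [NumberField E] [Algebra F E] [Algebra.IsQuadraticExtension F E]
  (c : E ≃ₐ[F] E) {N : ℕ} (J : Matrix (Fin N) (Fin N) E)

/-! ## §1 `det` at a complex place of `E`, as a continuous character of `U(J)(E ⊗ ℝ)` -/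

/-- **`detAtC w : U(J)(E ⊗ ℝ) →* ℂˣ`, `g ↦ σ_w(det g_w)`** — the determinant of the `w`-coordinate of `g`
(`w` any complex place of `E`). [cite: Kudla1994, §3] -/
def detAtC (w : {w : InfinitePlace E // w.IsComplex}) : arch F E c N J →* ℂˣ :=
  (Units.map (evalC E w : mixedSpace E →+* ℂ).toMonoidHom).comp
    ((Matrix.GeneralLinearGroup.det : GL (Fin N) (mixedSpace E) →* (mixedSpace E)ˣ).comp (arch F E c N J).subtype)

omit [NumberField F] [NumberField E] [Algebra.IsQuadraticExtension F E] in
/-- formula: `detAtC w g = det (g.map (·)_w)`. [cite: Kudla1994, §3] -/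
theorem coe_detAtC (w : {w : InfinitePlace E // w.IsComplex}) (g : arch F E c N J) :
    ((detAtC F E c J w g : ℂˣ) : ℂ) =
      ((((g : GL (Fin N) (mixedSpace E)) : Matrix (Fin N) (Fin N) (mixedSpace E))).map (evalC E w)).det := by
  simp only [detAtC, MonoidHom.comp_apply, Subgroup.coe_subtype, Units.coe_map, RingHom.toMonoidHom_eq_coe,
    MonoidHom.coe_coe, Matrix.GeneralLinearGroup.val_det_apply, RingHom.map_det, RingHom.mapMatrix_apply]

omit [NumberField F] [NumberField E] [Algebra.IsQuadraticExtension F E] in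
/-- `detAtC w` is continuous. [cite: Kudla1994, §3] -/
theorem continuous_detAtC (w : {w : InfinitePlace E // w.IsComplex}) :
    Continuous fun g : arch F E c N J => ((detAtC F E c J w g : ℂˣ) : ℂ) := by
  simp only [coe_detAtC]
  have hev : Continuous (evalC E w : mixedSpace E → ℂ) := (continuous_apply w).comp continuous_snd
  exact ((Units.continuous_val.comp continuous_subtype_val).matrix_map hev).matrix_det

/-! ## §2 Places over a complex place of the base: `ι_w` is onto; the places are `w ≠ c w` -/

omit [NumberField F] [NumberField E] [Algebra.IsQuadraticExtension F E] in
/-- **`ι_w : F_v → E_w` is onto for `v` complex** (`σ_w ∘ ι_w = placeTwist ∘ σ_v` with `σ_v`, `placeTwist`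
bijective). [cite: PlatonovRapinchuk1994, §3.2] -/
theorem toInfPlace_surjective_of_isComplex (v : {v : InfinitePlace F // v.IsComplex}) (w : InfPlacesOver E v.1) :
    Function.Surjective (toInfPlace E v.1 w) := by
  intro y
  refine ⟨(Completion.ringEquivComplexOfIsComplex v.2).symm
    (placeTwist F E v w (Completion.extensionEmbedding w.1 y)), (Completion.extensionEmbedding w.1).injective ?_⟩
  rw [← placeTwist_extensionEmbedding, ← Completion.ringEquivComplexOfIsComplex_apply v.2, RingEquiv.apply_symm_apply,
    placeTwist_placeTwist]

omit [NumberField F] [NumberField E] [Algebra.IsQuadraticExtension F E] in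
/-- **a place of `E` over a COMPLEX place of `F` is moved by `c ≠ 1`** (it is unramified, so its stabiliser is
trivial). [cite: PlatonovRapinchuk1994, §3.2] -/
theorem smul_ne_of_isComplex_comap (hc : c ≠ 1) (w : InfinitePlace E) (hv : (w.comap (algebraMap F E)).IsComplex) :
    c • w ≠ w := by
  intro h
  have hun : IsUnramified F w := isUnramified_iff.mpr (Or.inr hv)
  have hmem : c ∈ MulAction.stabilizer (E ≃ₐ[F] E) w := MulAction.mem_stabilizer_iff.mpr h
  rw [hun.stabilizer_eq_bot, Subgroup.mem_bot] at hmem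
  exact hc hmem

variable (v : {v : InfinitePlace F // v.IsComplex}) (w : {w : InfinitePlace E // w.IsComplex})
  (hover : w.1.comap (algebraMap F E) = v.1)

omit [NumberField F] [NumberField E] [Algebra.IsQuadraticExtension F E] in
/-- the place `w` over `v`, as a term of `InfPlacesOver E v`. [cite: PlatonovRapinchuk1994, §3.2] -/
abbrev placeOver : InfPlacesOver E v.1 := ⟨w.1, hover⟩

omit [NumberField F] [NumberField E] [Algebra.IsQuadraticExtension F E] in
/-- the partner `c w` over `v`, as a term of `InfPlacesOver E v`. [cite: PlatonovRapinchuk1994, §3.2] -/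
abbrev cPlaceOver : InfPlacesOver E v.1 := ⟨(cPlaceC F E c w).1, (comap_cPlaceC F E c w).trans hover⟩

omit [NumberField F] [NumberField E] [Algebra.IsQuadraticExtension F E] in
/-- `w ≠ c w` over a complex `v`. [cite: PlatonovRapinchuk1994, §3.2] -/
theorem placeOver_ne_cPlaceOver (hc : c ≠ 1) : placeOver F E v w hover ≠ cPlaceOver F E c v w hover := by
  intro h
  have h' : w.1 = c • w.1 := congrArg Subtype.val h
  exact smul_ne_of_isComplex_comap F E c hc w.1 (hover.symm ▸ v.2) h'.symm

/-- **the places of `E` over a complex `v` are `w` and `c w`** (`Gal(E/F) = {1, c}` acts transitively on the fibre).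
[cite: PlatonovRapinchuk1994, §3.2] -/
theorem eq_or_eq_cPlaceOver (hc : c ≠ 1) (w' : InfPlacesOver E v.1) :
    w' = placeOver F E v w hover ∨ w' = cPlaceOver F E c v w hover := by
  haveI : IsGalois F E := Algebra.IsQuadraticExtension.isGalois F E
  haveI : FiniteDimensional F E :=
    Module.finite_of_finrank_eq_succ (Algebra.IsQuadraticExtension.finrank_eq_two F E)
  obtain ⟨σ, hσ⟩ := exists_smul_eq_of_comap_eq (k := F) (w := w.1) (w' := w'.1) (hover.trans w'.2.symm)
  rcases algEquiv_eq_one_or_eq F E c (Algebra.IsQuadraticExtension.finrank_eq_two F E) hc σ with h1 | h2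
  · left
    rw [h1, one_smul] at hσ
    exact Subtype.ext hσ.symm
  · right
    rw [h2] at hσ
    exact Subtype.ext hσ.symm

/-- the fibre over a complex `v` is the pair `{w, c w}`. [cite: PlatonovRapinchuk1994, §3.2] -/
theorem univ_infPlacesOver_eq_pair (hc : c ≠ 1) :
    (Finset.univ : Finset (InfPlacesOver E v.1)) = {placeOver F E v w hover, cPlaceOver F E c v w hover} := by
  ext w'
  simp only [Finset.mem_univ, Finset.mem_insert, Finset.mem_singleton, true_iff]
  exact eq_or_eq_cPlaceOver F E c v w hover hc w'

/-! ## §3 The determinant identity over `E ⊗ ℝ`, read at a complex place -/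

section Doubled

variable {n : ℕ} (T : Matrix (Fin n) (Fin n) F) (hT : IsUnit T.det) (JD : Matrix (Fin (n + n)) (Fin (n + n)) E)
  (hJD : JD = (Matrix.reindex finSumFinEquiv finSumFinEquiv (Matrix.fromBlocks T 0 0 (-T))).map (algebraMap F E))

omit [NumberField F] [NumberField E] [Algebra.IsQuadraticExtension F E] in
include hJD in
/-- `J^𝔻 ⊗ 1 = e₂ (T_∞ ⊕ −T_∞) e₂` over `E ⊗ ℝ`, `T_∞ = T ⊗ 1`. [cite: Kudla1994, §3] -/
theorem archFormOf_doubledGram :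
    archFormOf E (n + n) JD =
      Matrix.reindex finSumFinEquiv finSumFinEquiv
        (Matrix.fromBlocks (T.map ((mixedEmbedding E).comp (algebraMap F E))) 0 0
          (-T.map ((mixedEmbedding E).comp (algebraMap F E)))) := by
  show JD.map (mixedEmbedding E) = _
  subst hJD
  rw [Matrix.map_map, ← RingHom.coe_comp]
  simp only [Matrix.reindex_apply]
  rw [← Matrix.submatrix_map, Matrix.fromBlocks_map, Matrix.map_zero _ (map_zero _), Matrix.map_neg _ (map_neg _)]

omit [Algebra.IsQuadraticExtension F E] in
include hT hJD in
/-- **`σ_w(det g_w) · ψ_{cw}(σ_{cw}(u_{cw})) = σ_w(u_w)` on `P_Δ`**, at every complex place `w` of `E`: for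
`g ∈ U(J^𝔻)(E ⊗ ℝ)` whose adelic matrix satisfies the Siegel relation and every idèle `u` equal to `x((g,1)) = det((g,1)|_Δ)`
— the identity `det g · (c ⊗ 1)(x(g)) = x(g)` over `E ⊗ ℝ` (`det_mul_map_det_deltaBlock_reindex`, involution
`c ⊗ 1 = conjMixed`), read at `w` (`conjMixed_snd_eq`). [cite: Kudla1994, §3] [cite: HarrisKudlaSweet1996, §1 (1.11)–(1.12)] -/
theorem detAtC_mul_conjCoord_eq (hcc : c * c = 1) (g : arch F E c (n + n) JD) (u : ideleGroup E)
    (hS : (Matrix.reindex finSumFinEquiv.symm finSumFinEquiv.symm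
            (((archToAdelic F E c (n + n) JD g).1 : GL (Fin (n + n)) (AdeleRing (𝓞 E) E)) :
              Matrix (Fin (n + n)) (Fin (n + n)) (AdeleRing (𝓞 E) E))).toBlocks₁₁ +
          (Matrix.reindex finSumFinEquiv.symm finSumFinEquiv.symm
            (((archToAdelic F E c (n + n) JD g).1 : GL (Fin (n + n)) (AdeleRing (𝓞 E) E)) :
              Matrix (Fin (n + n)) (Fin (n + n)) (AdeleRing (𝓞 E) E))).toBlocks₁₂ =
        (Matrix.reindex finSumFinEquiv.symm finSumFinEquiv.symm
            (((archToAdelic F E c (n + n) JD g).1 : GL (Fin (n + n)) (AdeleRing (𝓞 E) E)) :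
              Matrix (Fin (n + n)) (Fin (n + n)) (AdeleRing (𝓞 E) E))).toBlocks₂₁ +
          (Matrix.reindex finSumFinEquiv.symm finSumFinEquiv.symm
            (((archToAdelic F E c (n + n) JD g).1 : GL (Fin (n + n)) (AdeleRing (𝓞 E) E)) :
              Matrix (Fin (n + n)) (Fin (n + n)) (AdeleRing (𝓞 E) E))).toBlocks₂₂)
    (hu : ((u : ideleGroup E) : AdeleRing (𝓞 E) E) =
          ((Matrix.reindex finSumFinEquiv.symm finSumFinEquiv.symm
              (((archToAdelic F E c (n + n) JD g).1 : GL (Fin (n + n)) (AdeleRing (𝓞 E) E)) :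
                Matrix (Fin (n + n)) (Fin (n + n)) (AdeleRing (𝓞 E) E))).toBlocks₁₁ +
            (Matrix.reindex finSumFinEquiv.symm finSumFinEquiv.symm
              (((archToAdelic F E c (n + n) JD g).1 : GL (Fin (n + n)) (AdeleRing (𝓞 E) E)) :
                Matrix (Fin (n + n)) (Fin (n + n)) (AdeleRing (𝓞 E) E))).toBlocks₁₂).det)
    (w : {w : InfinitePlace E // w.IsComplex}) :
    ((detAtC F E c JD w g : ℂˣ) : ℂ) *
        conjCoord F E c (cPlaceC F E c w)
          (Completion.extensionEmbedding (cPlaceC F E c w).1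
            (((u : ideleGroup E) : AdeleRing (𝓞 E) E).1 (cPlaceC F E c w).1)) =
      Completion.extensionEmbedding w.1 (((u : ideleGroup E) : AdeleRing (𝓞 E) E).1 w.1) := by
  set G : Matrix (Fin (n + n)) (Fin (n + n)) (mixedSpace E) :=
    (((g : GL (Fin (n + n)) (mixedSpace E)) : Matrix (Fin (n + n)) (Fin (n + n)) (mixedSpace E))) with hG
  set M : Matrix (Fin (n + n)) (Fin (n + n)) (AdeleRing (𝓞 E) E) :=
    (((archToAdelic F E c (n + n) JD g).1 : GL (Fin (n + n)) (AdeleRing (𝓞 E) E)) :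
      Matrix (Fin (n + n)) (Fin (n + n)) (AdeleRing (𝓞 E) E)) with hM
  -- (1) the unitarity relation over `E ⊗ ℝ` in doubled form
  haveI : Invertible (2 : mixedSpace E) :=
    (Invertible.map (algebraMap ℝ (mixedSpace E)) 2).copy 2 (map_ofNat (algebraMap ℝ (mixedSpace E)) 2).symm
  have hmem : (G.map (conjMixed F E c))ᵀ *
        Matrix.reindex finSumFinEquiv finSumFinEquiv
          (Matrix.fromBlocks (T.map ((mixedEmbedding E).comp (algebraMap F E))) 0 0
            (-T.map ((mixedEmbedding E).comp (algebraMap F E)))) * G =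
      Matrix.reindex finSumFinEquiv finSumFinEquiv
        (Matrix.fromBlocks (T.map ((mixedEmbedding E).comp (algebraMap F E))) 0 0
          (-T.map ((mixedEmbedding E).comp (algebraMap F E)))) := by
    have h := (mem_arch_iff F E c (n + n) JD (g : GL (Fin (n + n)) (mixedSpace E))).1 g.2
    rwa [archFormOf_doubledGram F E T JD hJD] at h
  have hTinf : IsUnit (T.map ((mixedEmbedding E).comp (algebraMap F E))).det := by
    have h := hT.map ((mixedEmbedding E).comp (algebraMap F E))
    rwa [RingHom.map_det, RingHom.mapMatrix_apply] at h
  -- (2) the Siegel relation over `E ⊗ ℝ`: transport along `ρ : 𝔸_E → E_∞ ≅ E ⊗ ℝ`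
  set ρ : AdeleRing (𝓞 E) E →+* mixedSpace E :=
    (InfiniteAdeleRing.ringEquiv_mixedSpace E).toRingHom.comp (adeleFst E) with hρ
  have hmap : M.map ρ = G := by
    have h1 : M.map (adeleFst E) = G.map (InfiniteAdeleRing.ringEquiv_mixedSpace E).symm.toRingHom :=
      map_fst_ofInfinite E (n + n) (g : GL (Fin (n + n)) (mixedSpace E))
    have h2 : M.map ρ = (M.map (adeleFst E)).map (InfiniteAdeleRing.ringEquiv_mixedSpace E) := by
      rw [Matrix.map_map]; rfl
    rw [h2, h1, Matrix.map_map]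
    exact Matrix.ext fun i j => (InfiniteAdeleRing.ringEquiv_mixedSpace E).apply_symm_apply _
  have hS' : (Matrix.reindex finSumFinEquiv.symm finSumFinEquiv.symm G).toBlocks₁₁ +
        (Matrix.reindex finSumFinEquiv.symm finSumFinEquiv.symm G).toBlocks₁₂ =
      (Matrix.reindex finSumFinEquiv.symm finSumFinEquiv.symm G).toBlocks₂₁ +
        (Matrix.reindex finSumFinEquiv.symm finSumFinEquiv.symm G).toBlocks₂₂ := by
    have h := congrArg (fun X : Matrix (Fin n) (Fin n) (AdeleRing (𝓞 E) E) => X.map ρ) hS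
    simp only [Matrix.map_add ρ (map_add ρ)] at h
    rw [← hmap]
    exact h
  -- (3) `det G · (c ⊗ 1)(x(G)) = x(G)` over `E ⊗ ℝ`
  have hσ : ∀ x : mixedSpace E, conjMixed F E c (conjMixed F E c x) = x := fun x => by
    have h := conjMixed_inv_apply F E c x
    rwa [inv_eq_of_mul_eq_one_right hcc] at h
  have key := det_mul_map_det_deltaBlock_reindex finSumFinEquiv hmem hS' hTinf hσ
  -- (4) read at `w`
  have hΔ : ∀ w' : {w : InfinitePlace E // w.IsComplex},
      evalC E w' ((Matrix.reindex finSumFinEquiv.symm finSumFinEquiv.symm G).toBlocks₁₁ +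
          (Matrix.reindex finSumFinEquiv.symm finSumFinEquiv.symm G).toBlocks₁₂).det =
        Completion.extensionEmbedding w'.1 (((u : ideleGroup E) : AdeleRing (𝓞 E) E).1 w'.1) := by
    intro w'
    have hGM : G.map (evalC E w') = M.map (adeleAt E w') :=
      Matrix.ext fun i j => (adeleAt_coe_archToAdelic F E c JD w' g i j).symm
    rw [map_det_deltaBlock_finSum (evalC E w') G, hGM, ← map_det_deltaBlock_finSum (adeleAt E w') M, ← hu,
      adeleAt_apply]
  have hk := congrArg (evalC E w) key
  rw [map_mul, hΔ w, evalC_apply E w (conjMixed F E c _), conjMixed_snd_eq F E c hcc, ← evalC_apply E (cPlaceC F E c w),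
    hΔ (cPlaceC F E c w)] at hk
  rw [coe_detAtC, ← RingHom.mapMatrix_apply, ← RingHom.map_det]
  exact hk

/-! ## §4 The character identity at a complex place of the base -/

/-- **`χ̃_w := χ_w ∘ σ_w⁻¹ : ℂˣ →* ℂˣ`** — the archimedean component at the complex place `w` in the complex
coordinate `σ_w : E_w ≅ ℂ`. [cite: TateThesis1967, §4.3] -/
def archComponentC (χ : HeckeCharacter E) (w : {w : InfinitePlace E // w.IsComplex}) : ℂˣ →* ℂˣ :=
  (χ.archComponent w.1).comp
    (Units.map (Completion.ringEquivComplexOfIsComplex w.2).symm.toRingHom.toMonoidHom)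

omit [NumberField F] [Algebra.IsQuadraticExtension F E] [Algebra F E] in
/-- `χ̃_w` is continuous. [cite: TateThesis1967, §4.3] -/
theorem continuous_archComponentC (χ : HeckeCharacter E) (w : {w : InfinitePlace E // w.IsComplex}) :
    Continuous (archComponentC E χ w) :=
  (continuous_archComponent χ w.1).comp
    (Continuous.units_map _ (Completion.isometryEquivComplexOfIsComplex w.2).symm.continuous)

omit [NumberField F] [Algebra.IsQuadraticExtension F E] [Algebra F E] in
/-- `χ̃_w (σ_w y) = χ_w(y)`. [cite: TateThesis1967, §4.3] -/
theorem archComponentC_map (χ : HeckeCharacter E) (w : {w : InfinitePlace E // w.IsComplex}) (y : (w.1.Completion)ˣ) :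
    archComponentC E χ w (Units.map (Completion.extensionEmbedding w.1).toMonoidHom y) = χ.archComponent w.1 y := by
  have h : Units.map (Completion.ringEquivComplexOfIsComplex w.2).symm.toRingHom.toMonoidHom
      (Units.map (Completion.extensionEmbedding w.1).toMonoidHom y) = y := by
    apply Units.ext
    change (Completion.ringEquivComplexOfIsComplex w.2).symm
      (Completion.extensionEmbedding w.1 (y : w.1.Completion)) = (y : w.1.Completion)
    rw [← Completion.ringEquivComplexOfIsComplex_apply w.2, RingEquiv.symm_apply_apply]
  simp only [archComponentC, MonoidHom.comp_apply, h]

include hT hJD hover in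
/-- **`χ̃_w(σ_w(det g_w)) = χ_w(u_w) · χ_{cw}(u_{cw})` on `P_Δ`** (complex `v`, `w ∣ v`, `χ|_{𝕀_F} = ε_{E/F}^m`): the
factor of `χ(x((g,1)))` at the two places over `v` is the value at `g` of the continuous character `χ̃_w ∘ detAtC w`
of `U(J^𝔻)(E ⊗ ℝ)`. [cite: GelbartRogawski1991, §3.1 p. 456 (3.1.2)] [cite: Kudla1994, §3] -/
theorem archComponentC_detAtC_eq (hc : c ≠ 1) (hcc : c * c = 1) {m : ℕ} {χ : HeckeCharacter E}
    (hχ : IsSplittingCharExt F E m χ) (g : arch F E c (n + n) JD) (u : ideleGroup E)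
    (hS : (Matrix.reindex finSumFinEquiv.symm finSumFinEquiv.symm
            (((archToAdelic F E c (n + n) JD g).1 : GL (Fin (n + n)) (AdeleRing (𝓞 E) E)) :
              Matrix (Fin (n + n)) (Fin (n + n)) (AdeleRing (𝓞 E) E))).toBlocks₁₁ +
          (Matrix.reindex finSumFinEquiv.symm finSumFinEquiv.symm
            (((archToAdelic F E c (n + n) JD g).1 : GL (Fin (n + n)) (AdeleRing (𝓞 E) E)) :
              Matrix (Fin (n + n)) (Fin (n + n)) (AdeleRing (𝓞 E) E))).toBlocks₁₂ =
        (Matrix.reindex finSumFinEquiv.symm finSumFinEquiv.symm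
            (((archToAdelic F E c (n + n) JD g).1 : GL (Fin (n + n)) (AdeleRing (𝓞 E) E)) :
              Matrix (Fin (n + n)) (Fin (n + n)) (AdeleRing (𝓞 E) E))).toBlocks₂₁ +
          (Matrix.reindex finSumFinEquiv.symm finSumFinEquiv.symm
            (((archToAdelic F E c (n + n) JD g).1 : GL (Fin (n + n)) (AdeleRing (𝓞 E) E)) :
              Matrix (Fin (n + n)) (Fin (n + n)) (AdeleRing (𝓞 E) E))).toBlocks₂₂)
    (hu : ((u : ideleGroup E) : AdeleRing (𝓞 E) E) =
          ((Matrix.reindex finSumFinEquiv.symm finSumFinEquiv.symm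
              (((archToAdelic F E c (n + n) JD g).1 : GL (Fin (n + n)) (AdeleRing (𝓞 E) E)) :
                Matrix (Fin (n + n)) (Fin (n + n)) (AdeleRing (𝓞 E) E))).toBlocks₁₁ +
            (Matrix.reindex finSumFinEquiv.symm finSumFinEquiv.symm
              (((archToAdelic F E c (n + n) JD g).1 : GL (Fin (n + n)) (AdeleRing (𝓞 E) E)) :
                Matrix (Fin (n + n)) (Fin (n + n)) (AdeleRing (𝓞 E) E))).toBlocks₁₂).det) :
    archComponentC E χ w (detAtC F E c JD w g) =
      χ.archComponent w.1 (ideleInfiniteComponent E w.1 u) *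
        χ.archComponent (cPlaceC F E c w).1 (ideleInfiniteComponent E (cPlaceC F E c w).1 u) := by
  -- `x ∈ F_vˣ` with `ι_{cw} x = u_{cw}`
  obtain ⟨x₀, hx₀⟩ := toInfPlace_surjective_of_isComplex F E v (cPlaceOver F E c v w hover)
    ((ideleInfiniteComponent E (cPlaceC F E c w).1 u : ((cPlaceC F E c w).1.Completion)ˣ) : (cPlaceC F E c w).1.Completion)
  have hx₀0 : x₀ ≠ 0 := by
    intro h
    rw [h, map_zero] at hx₀
    exact (ideleInfiniteComponent E (cPlaceC F E c w).1 u).ne_zero hx₀.symm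
  set x : (v.1.Completion)ˣ := Units.mk0 x₀ hx₀0 with hx
  have hxcw : Units.map (toInfPlace E v.1 (cPlaceOver F E c v w hover)).toMonoidHom x =
      ideleInfiniteComponent E (cPlaceC F E c w).1 u := Units.ext hx₀
  -- `y' = ι_w x`, with `σ_w(y') = ψ_{cw}(σ_{cw}(u_{cw}))`
  set y' : (w.1.Completion)ˣ := Units.map (toInfPlace E v.1 (placeOver F E v w hover)).toMonoidHom x with hy'
  have hσy' : Completion.extensionEmbedding w.1 (y' : w.1.Completion) =
      conjCoord F E c (cPlaceC F E c w)
        (Completion.extensionEmbedding (cPlaceC F E c w).1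
          (((u : ideleGroup E) : AdeleRing (𝓞 E) E).1 (cPlaceC F E c w).1)) := by
    have h1 : Completion.extensionEmbedding w.1 (y' : w.1.Completion) =
        placeTwist F E v (placeOver F E v w hover) (Completion.extensionEmbedding v.1 x₀) := by
      rw [hy', Units.coe_map, RingHom.toMonoidHom_eq_coe, MonoidHom.coe_coe, hx, Units.val_mk0,
        placeTwist_extensionEmbedding]
    rw [h1, ← conjCoord_placeTwist_cPlaceC F E c hcc v w hover, placeTwist_extensionEmbedding, hx₀,
      val_ideleInfiniteComponent]
  -- the determinant identity: `u_w = σ_w⁻¹(det_w g) · y'`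
  have hdet := detAtC_mul_conjCoord_eq F E c T hT JD hJD hcc g u hS hu w
  rw [← hσy'] at hdet
  have huw : ideleInfiniteComponent E w.1 u =
      Units.map (Completion.ringEquivComplexOfIsComplex w.2).symm.toRingHom.toMonoidHom (detAtC F E c JD w g) * y' := by
    apply Units.ext
    apply (Completion.extensionEmbedding w.1).injective
    rw [val_ideleInfiniteComponent, ← hdet, Units.val_mul, map_mul]
    congr 1
    change _ = Completion.extensionEmbedding w.1
      ((Completion.ringEquivComplexOfIsComplex w.2).symm ((detAtC F E c JD w g : ℂˣ) : ℂ))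
    rw [← Completion.ringEquivComplexOfIsComplex_apply w.2, RingEquiv.apply_symm_apply]
  -- the local splitting identity at the pair `(w, cw)`
  have hpair := hχ.archComponent_mul_archComponent_of_isComplex v.2 (placeOver F E v w hover)
    (cPlaceOver F E c v w hover) (placeOver_ne_cPlaceOver F E c v w hover hc)
    (eq_or_eq_cPlaceOver F E c v w hover hc) x
  rw [hxcw, ← hy'] at hpair
  rw [huw, map_mul, mul_assoc]
  change archComponentC E χ w _ = archComponentC E χ w _ * (χ.archComponent w.1 y' * _)
  rw [hpair, mul_one]

include hT hJD hover in
/-- **product form: `∏_{w' ∣ v} χ_{w'}(u_{w'}) = χ̃_w(σ_w(det g_w))`** over the complex place `v`.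
[cite: GelbartRogawski1991, §3.1 p. 456 (3.1.2)] [cite: Kudla1994, §3] -/
theorem prod_archComponent_placesOver_eq_archComponentC_detAtC (hc : c ≠ 1) (hcc : c * c = 1) {m : ℕ}
    {χ : HeckeCharacter E} (hχ : IsSplittingCharExt F E m χ) (g : arch F E c (n + n) JD) (u : ideleGroup E)
    (hS : (Matrix.reindex finSumFinEquiv.symm finSumFinEquiv.symm
            (((archToAdelic F E c (n + n) JD g).1 : GL (Fin (n + n)) (AdeleRing (𝓞 E) E)) :
              Matrix (Fin (n + n)) (Fin (n + n)) (AdeleRing (𝓞 E) E))).toBlocks₁₁ +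
          (Matrix.reindex finSumFinEquiv.symm finSumFinEquiv.symm
            (((archToAdelic F E c (n + n) JD g).1 : GL (Fin (n + n)) (AdeleRing (𝓞 E) E)) :
              Matrix (Fin (n + n)) (Fin (n + n)) (AdeleRing (𝓞 E) E))).toBlocks₁₂ =
        (Matrix.reindex finSumFinEquiv.symm finSumFinEquiv.symm
            (((archToAdelic F E c (n + n) JD g).1 : GL (Fin (n + n)) (AdeleRing (𝓞 E) E)) :
              Matrix (Fin (n + n)) (Fin (n + n)) (AdeleRing (𝓞 E) E))).toBlocks₂₁ +
          (Matrix.reindex finSumFinEquiv.symm finSumFinEquiv.symm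
            (((archToAdelic F E c (n + n) JD g).1 : GL (Fin (n + n)) (AdeleRing (𝓞 E) E)) :
              Matrix (Fin (n + n)) (Fin (n + n)) (AdeleRing (𝓞 E) E))).toBlocks₂₂)
    (hu : ((u : ideleGroup E) : AdeleRing (𝓞 E) E) =
          ((Matrix.reindex finSumFinEquiv.symm finSumFinEquiv.symm
              (((archToAdelic F E c (n + n) JD g).1 : GL (Fin (n + n)) (AdeleRing (𝓞 E) E)) :
                Matrix (Fin (n + n)) (Fin (n + n)) (AdeleRing (𝓞 E) E))).toBlocks₁₁ +
            (Matrix.reindex finSumFinEquiv.symm finSumFinEquiv.symm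
              (((archToAdelic F E c (n + n) JD g).1 : GL (Fin (n + n)) (AdeleRing (𝓞 E) E)) :
                Matrix (Fin (n + n)) (Fin (n + n)) (AdeleRing (𝓞 E) E))).toBlocks₁₂).det) :
    ∏ w' : InfPlacesOver E v.1, χ.archComponent w'.1 (ideleInfiniteComponent E w'.1 u) =
      archComponentC E χ w (detAtC F E c JD w g) := by
  rw [univ_infPlacesOver_eq_pair F E c v w hover hc, Finset.prod_pair (placeOver_ne_cPlaceOver F E c v w hover hc),
    archComponentC_detAtC_eq F E c v w hover T hT JD hJD hc hcc hχ g u hS hu]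

end Doubled

end Literature.NumberTheory.GelbartRogawski1991.UnitaryDualPair.ArchSplitting.QuadExt

end
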